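import Mathlib
import HarnessLib

/-!
# Root substitutions `x_b ↦ x_b^d`, `x_s ↦ x_s · x_b^{e_s}` are injective (generic)

(crux stmt-ResolutionOfSingularities-15640 `WildQuotients.WildQuotientResolution`, line `Sketch`,
sector `|G| = p`; programmes V3U/V4U of `L/w45c/CHAIN.md` v5 — the root charts of the toric exits:
V3U chart a (`x_a ↦ ρ²`, `x_b ↦ ρβ`: pivot `a`, `d = 2`, `e_b = 1`), V4U chart `D₊(x_b³ t)`
(`x_b ↦ β²`, `x_a ↦ x_a β³`, `x_c ↦ x_c β`: pivot `b`, `d = 2`, `e = (3, ·, 1)`), V4U chart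
`D₊(x_a² t)` (`x_a ↦ α³`, `x_b ↦ x_b α²`, `x_c ↦ x_c α`: pivot `a`, `d = 3`, `e = (·, 2, 1)`);
[OURS · L1 W4.5c] — NOT a statement of any manuscript.)

`monomialTwist_injective`: the `k`-algebra endomorphism of `k[x₁,…,xₙ]` with `x_b ↦ x_b^d`
(`d ≥ 1`) and `x_s ↦ x_s · x_b^{e_s}` (`s ≠ b`) is injective — it is `Polynomial.expand d` in the
variable `b` (injective) followed by the twist `x_s ↦ x_s x_b^{e_s}`, which is retracted by
`x_s ↦ x_s / x_b^{e_s}` in `k[x][1/x_b]`. This is the `hψinj` input of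
`ToricExit.nonempty_chartRing_ringEquiv_adjoin_of_rootData`.
-/

-- single-problem summit: the doubled namespace component `ResolutionOfSingularities` is forced
set_option linter.dupNamespace false

noncomputable section

open MvPolynomial IsLocalization

namespace Summit.ResolutionOfSingularities.ResolutionOfSingularities.Theorems.WildQuotientResolution.ToricExit

/-- **The twist `x_s ↦ x_s · x_b^{e_s}` (`s ≠ b`), `x_b ↦ x_b`, is injective**: after inverting
`x_b` it is retracted by `x_s ↦ x_s / x_b^{e_s}`. [folklore] -/
theorem twist_injective (k : Type) [Field k] (n : ℕ) (b : Fin n) (e : Fin n → ℕ) :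
    Function.Injective (fun f : MvPolynomial (Fin n) k =>
      MvPolynomial.aeval (fun s => (if s = b then X b else X s * X b ^ e s :
        MvPolynomial (Fin n) k)) f) := by
  classical
  let τ : MvPolynomial (Fin n) k →ₐ[k] MvPolynomial (Fin n) k :=
    aeval fun s => if s = b then X b else X s * X b ^ e s
  let L := Localization.Away (X b : MvPolynomial (Fin n) k)
  let θ : MvPolynomial (Fin n) k →ₐ[k] L :=
    aeval fun s => if s = b then algebraMap (MvPolynomial (Fin n) k) L (X b)
      else algebraMap (MvPolynomial (Fin n) k) L (X s) *
        Away.invSelf (X b : MvPolynomial (Fin n) k) ^ e s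
  have hu : algebraMap (MvPolynomial (Fin n) k) L (X b) *
      Away.invSelf (X b : MvPolynomial (Fin n) k) = 1 := Away.mul_invSelf _
  have hθ : ∀ f, θ (τ f) = algebraMap (MvPolynomial (Fin n) k) L f := by
    intro f
    have h : θ.comp τ = IsScalarTower.toAlgHom k (MvPolynomial (Fin n) k) L := by
      refine MvPolynomial.algHom_ext fun s => ?_
      by_cases hs : s = b
      · subst hs
        simp [τ, θ]
      · simp only [τ, θ, AlgHom.comp_apply, aeval_X, hs, if_false, map_mul, map_pow, if_true,
          IsScalarTower.toAlgHom_apply]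
        have hu' : Away.invSelf (X b : MvPolynomial (Fin n) k) *
            algebraMap (MvPolynomial (Fin n) k) L (X b) = 1 := by rw [mul_comm]; exact hu
        calc _ = algebraMap (MvPolynomial (Fin n) k) L (X s) *
              (Away.invSelf (X b : MvPolynomial (Fin n) k) *
                algebraMap (MvPolynomial (Fin n) k) L (X b)) ^ e s := by ring
          _ = _ := by rw [hu', one_pow, mul_one]
    exact DFunLike.congr_fun h f
  intro f g hfg
  have h := congrArg θ hfg
  change θ (τ f) = θ (τ g) at h
  rw [hθ, hθ] at h
  exact IsLocalization.injective L (M := Submonoid.powers (X b : MvPolynomial (Fin n) k))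
    (Submonoid.powers_le.2 (mem_nonZeroDivisors_of_ne_zero (X_ne_zero b))) h

/-- **`x_b ↦ x_b^d` (`d ≥ 1`, other variables fixed) is injective**: it is `Polynomial.expand d`
in the variable `b` (`MvPolynomial.optionEquivLeft ∘ renameEquiv (Equiv.optionSubtypeNe b)`).
[folklore] -/
theorem powSubst_injective (k : Type) [Field k] (n : ℕ) (b : Fin n) (d : ℕ) (hd : 0 < d) :
    Function.Injective (fun f : MvPolynomial (Fin n) k =>
      MvPolynomial.aeval (fun s => (if s = b then X b ^ d else X s : MvPolynomial (Fin n) k)) f) := by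
  classical
  let τ : MvPolynomial (Fin n) k →ₐ[k] MvPolynomial (Fin n) k :=
    aeval fun s => if s = b then X b ^ d else X s
  let Ξ : MvPolynomial (Fin n) k ≃ₐ[k] Polynomial (MvPolynomial {i : Fin n // i ≠ b} k) :=
    (MvPolynomial.renameEquiv k (Equiv.optionSubtypeNe b).symm).trans
      (MvPolynomial.optionEquivLeft k {i : Fin n // i ≠ b})
  have hΞb : (Ξ : MvPolynomial (Fin n) k →ₐ[k] Polynomial (MvPolynomial {i : Fin n // i ≠ b} k))
      (X b) = Polynomial.X := by
    change Ξ (X b) = Polynomial.X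
    simp only [Ξ, AlgEquiv.trans_apply, MvPolynomial.renameEquiv_apply, MvPolynomial.rename_X,
      Equiv.optionSubtypeNe_symm_self, MvPolynomial.optionEquivLeft_X_none]
  have hΞi : ∀ (i : Fin n) (hi : i ≠ b),
      (Ξ : MvPolynomial (Fin n) k →ₐ[k] Polynomial (MvPolynomial {i : Fin n // i ≠ b} k)) (X i) =
        Polynomial.C (X ⟨i, hi⟩) := by
    intro i hi
    change Ξ (X i) = _
    simp only [Ξ, AlgEquiv.trans_apply, MvPolynomial.renameEquiv_apply, MvPolynomial.rename_X,
      Equiv.optionSubtypeNe_symm_of_ne hi, MvPolynomial.optionEquivLeft_X_some]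
  let E2 : Polynomial (MvPolynomial {i : Fin n // i ≠ b} k) →ₐ[k]
      Polynomial (MvPolynomial {i : Fin n // i ≠ b} k) :=
    (Polynomial.expand (MvPolynomial {i : Fin n // i ≠ b} k) d).restrictScalars k
  have key : ∀ f, Ξ (τ f) = E2 (Ξ f) := by
    intro f
    have h : (Ξ : MvPolynomial (Fin n) k →ₐ[k] _).comp τ =
        E2.comp (Ξ : MvPolynomial (Fin n) k →ₐ[k] _) := by
      refine MvPolynomial.algHom_ext fun i => ?_
      by_cases hi : i = b
      · subst hi
        simp only [AlgHom.comp_apply, τ, E2, aeval_X, if_true, map_pow, hΞb,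
          AlgHom.coe_restrictScalars', Polynomial.expand_X]
      · simp only [AlgHom.comp_apply, τ, E2, aeval_X, hi, if_false, hΞi i hi,
          AlgHom.coe_restrictScalars', Polynomial.expand_C]
    exact DFunLike.congr_fun h f
  intro f g hfg
  apply Ξ.injective
  apply Polynomial.expand_injective hd
  have h := congrArg Ξ hfg
  change Ξ (τ f) = Ξ (τ g) at h
  rw [key, key] at h
  exact h

/-- **Root substitutions are injective**: `x_b ↦ x_b^d` (`d ≥ 1`), `x_s ↦ x_s · x_b^{e_s}`
(`s ≠ b`) — the composite of `powSubst_injective` and `twist_injective`. Instances: V3U chart a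
(`ρ², ρβ`), V4U `μ₂` chart (`x_aβ³, β², x_cβ`), V4U `μ₃` chart (`α³, x_bα², x_cα`). [folklore] -/
theorem monomialTwist_injective (k : Type) [Field k] (n : ℕ) (b : Fin n) (d : ℕ) (hd : 0 < d)
    (e : Fin n → ℕ) :
    Function.Injective (fun f : MvPolynomial (Fin n) k =>
      MvPolynomial.aeval (fun s => (if s = b then X b ^ d else X s * X b ^ e s :
        MvPolynomial (Fin n) k)) f) := by
  classical
  let τ₁ : MvPolynomial (Fin n) k →ₐ[k] MvPolynomial (Fin n) k :=
    aeval fun s => if s = b then X b ^ d else X s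
  let τ₂ : MvPolynomial (Fin n) k →ₐ[k] MvPolynomial (Fin n) k :=
    aeval fun s => if s = b then X b else X s * X b ^ e s
  have hcomp : ∀ f : MvPolynomial (Fin n) k,
      MvPolynomial.aeval (fun s => (if s = b then X b ^ d else X s * X b ^ e s :
        MvPolynomial (Fin n) k)) f = τ₂ (τ₁ f) := by
    intro f
    have h : (MvPolynomial.aeval (fun s => (if s = b then X b ^ d else X s * X b ^ e s :
        MvPolynomial (Fin n) k)) : MvPolynomial (Fin n) k →ₐ[k] MvPolynomial (Fin n) k) =
          τ₂.comp τ₁ := by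
      refine MvPolynomial.algHom_ext fun s => ?_
      by_cases hs : s = b
      · subst hs
        simp [τ₁, τ₂]
      · simp [τ₁, τ₂, hs]
    exact DFunLike.congr_fun h f
  intro f g hfg
  have h : τ₂ (τ₁ f) = τ₂ (τ₁ g) := by rw [← hcomp, ← hcomp]; exact hfg
  exact powSubst_injective k n b d hd (twist_injective k n b e h)

end Summit.ResolutionOfSingularities.ResolutionOfSingularities.Theorems.WildQuotientResolution.ToricExit

end
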